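import Literature.Algebra.Homology.LaurentCechExact
import Mathlib.RingTheory.GradedAlgebra.HomogeneousLocalization
import Mathlib.RingTheory.Localization.Away.Basic
import HarnessLib

/-!
# The degree-zero localizations `(A[x]_{(X_s)})₀` inside Laurent polynomials

Bridge between Mathlib's homogeneous localizations and the Laurent model of
`Literature/Algebra/Homology/LaurentCech` (`P = A[x₀, …, x_r] ⊆ L = A[x^{±1}]`): for a set `s` of
variables with monomial `X_s = Π_{i ∈ s} x_i`,

* `LaurentCech.Bsub A r s ⊆ L` — the `A`-subalgebra `B_s` of degree-`0` Laurent polynomials `x` with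
  `x_s^N x ∈ P` for some `N` (equivalently: non-negative exponents off `s`, `mem_Bsub_iff_nonneg`); it is
  the degree-`0` localized piece of the rank-one free module (`mem_Bsub_iff_const_mem_locDeg`), monotone
  in `s`;
* `LaurentCech.awayToL`, `LaurentCech.awayEquiv A r s : (P_{(X_s)})₀ ≃+* B_s` — **Mathlib's
  `HomogeneousLocalization.Away` of `P` at `X_s` is the subalgebra `B_s`** (`p / X_s^n ↦ p x_s^{-n}`;
  Hartshorne II Prop. 2.5 (b) and the proof of III Thm. 5.1: `S_{(x_{i₀}⋯x_{i_p})}` is spanned by Laurent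
  monomials), compatible with the transition maps `HomogeneousLocalization.awayMap`
  (`awayToL_awayMap`) and with the structure maps from `A` (`awayToL_fromZeroRingHom`);
* `LaurentCech.tEl A s j = X_{s∖j} / x_j^{#(s∖j)}` — the image of Mathlib's `Away.isLocalizationElem`
  (the element `t` with `D₊(x_j X_{s∖j}) = D₊(x_j) ∩ D(t)`), the clearing-denominators lemma
  `exists_mul_tEl_pow_mem` (`x ∈ B_{s+j} ⇒ x t^k ∈ B_{{j}}` for `k ≫ 0`) and
  `xs_mul_xs_single_eq_tEl_pow`;
* `LaurentCech.hcomp_mul`, `LaurentCech.fracB A j b k = k_b / x_j^b ∈ B_{{j}}` with `fracB_mul`,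
  `fracB_hcomp` — homogeneous components of products and the fractions entering the homogeneous ideal of
  a closed subscheme of `𝐏^r_A` (`Literature/AlgebraicGeometry/Morphisms/CechH1Projective`).

Everything is proved. Mathlib searched (pin v4.32): `HomogeneousLocalization.Away` (`Away.mk`,
`Away.mk_surjective`, `awayMap`, `awayMap_mk`, `Away.isLocalizationElem`), `Localization.awayLift`
(used); Mathlib has no comparison of `HomogeneousLocalization` with Laurent polynomials.

## References

* R. Hartshorne, *Algebraic Geometry*, GTM 52, Springer (1977): II Prop. 2.5 (b); III Thm. 5.1 and its
  proof (pp. 225–227). [Hartshorne1977]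
* The Stacks Project, Tag 01XT (cohomology of projective space, proof). [StacksProject]
-/

noncomputable section

open Finset AddMonoidAlgebra

universe u

attribute [local instance] MvPolynomial.gradedAlgebra

namespace Literature.Algebra.Homology

namespace LaurentCech

variable {A : Type u} [CommRing A] {r : ℕ}

/-! ### The subalgebra `B_s = (P_{X_s})₀ ⊆ L` -/

variable (A r) in
/-- The degree-zero localization `B_s = (P_{X_s})₀` of `P = A[x₀, …, x_r]` at the monomial
`X_s = Π_{i ∈ s} x_i`, realised as the `A`-subalgebra of the Laurent polynomial ring `L` of the
degree-`0` Laurent polynomials `x` with `x_s^N x ∈ P` for some `N`. [folklore] -/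
def Bsub (s : Finset (Fin (r + 1))) : Subalgebra A (L A r) where
  carrier := {x | x ∈ Ldeg A r 0 ∧ ∃ (N : ℕ) (p : P A r), xs A s N * x = toL A r p}
  mul_mem' := by
    rintro x y ⟨hx, N, p, hp⟩ ⟨hy, N', p', hp'⟩
    refine ⟨by simpa using mul_mem_Ldeg hx hy, N + N', p * p', ?_⟩
    rw [map_mul, ← hp, ← hp', Nat.cast_add, xs_add]; ring
  add_mem' := by
    rintro x y ⟨hx, N, p, hp⟩ ⟨hy, N', p', hp'⟩
    refine ⟨add_mem hx hy, N + N', Xs A s ^ N' * p + Xs A s ^ N * p', ?_⟩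
    rw [map_add, map_mul, map_mul, toL_Xs_pow, toL_Xs_pow, ← hp, ← hp', Nat.cast_add, xs_add]
    ring
  algebraMap_mem' a := by
    refine ⟨?_, 0, MvPolynomial.C a, ?_⟩
    · rw [Algebra.algebraMap_eq_smul_one, AddMonoidAlgebra.one_def, AddMonoidAlgebra.smul_single]
      exact single_mem_Ldeg (by simp) _
    · rw [Nat.cast_zero, xs_zero, one_mul, ← MvPolynomial.algebraMap_eq]
      exact ((toL A r).commutes a).symm

/-- Membership in `B_s`. [folklore] -/
theorem mem_Bsub {s : Finset (Fin (r + 1))} {x : L A r} :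
    x ∈ Bsub A r s ↔ x ∈ Ldeg A r 0 ∧ ∃ (N : ℕ) (p : P A r), xs A s N * x = toL A r p := Iff.rfl

/-- `B_s` is the degree-`0` localized piece of the free module of rank one: `x ∈ B_s` iff the
constant vector `x` lies in `(P_s)_0 ⊆ L^J` (`LaurentCech.locDeg` for `K = ⊤`, `e = 0`). [folklore] -/
theorem mem_Bsub_iff_const_mem_locDeg {J : Type} [Nonempty J] {s : Finset (Fin (r + 1))} {x : L A r} :
    x ∈ Bsub A r s ↔
      (fun _ : J => x) ∈ locDeg (0 : J → ℤ) (⊤ : Submodule (P A r) (J → P A r)) s 0 := by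
  rw [mem_Bsub, mem_locDeg, mem_loc, mem_Kdeg]
  constructor
  · rintro ⟨h0, N, p, hp⟩
    exact ⟨⟨N, fun _ => p, Submodule.mem_top, funext fun _ => by simpa using hp⟩,
      fun j => by simpa using h0⟩
  · rintro ⟨⟨N, k, -, hk⟩, hdeg⟩
    obtain ⟨j⟩ := ‹Nonempty J›
    refine ⟨by simpa using hdeg j, N, k j, ?_⟩
    have := congr_fun hk j
    simpa using this

/-- `B_s ⊆ B_t` for `s ⊆ t`. [folklore] -/
theorem Bsub_mono {s t : Finset (Fin (r + 1))} (hst : s ⊆ t) : Bsub A r s ≤ Bsub A r t := by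
  rintro x ⟨hx, N, p, hp⟩
  refine ⟨hx, N, Xs A (t \ s) ^ N * p, ?_⟩
  rw [map_mul, toL_Xs_pow, ← hp, ← mul_assoc, ← xs_eq_sdiff_mul hst]

/-- Monomials in `B_s` are non-negative outside `s`. [folklore] -/
theorem nonneg_of_mem_Bsub {s : Finset (Fin (r + 1))} {x : L A r} (hx : x ∈ Bsub A r s) {m : Expt r}
    (hm : x.coeff m ≠ 0) {i : Fin (r + 1)} (hi : i ∉ s) : 0 ≤ m i := by
  obtain ⟨-, N, p, hp⟩ := hx
  have h2 : x = xs A s (-N) * toL A r p := by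
    rw [← hp, ← mul_assoc, xs_neg_mul_xs, one_mul]
  rw [h2, xs, coeff_single_mul, one_mul] at hm
  by_contra hlt
  push Not at hlt
  apply hm
  apply coeff_toL_eq_zero
  refine ⟨i, ?_⟩
  simp [sx_apply, hi, hlt]

/-- Degree-`0` Laurent polynomials whose monomials are non-negative outside `s` lie in `B_s`.
[folklore] -/
theorem mem_Bsub_of_nonneg {s : Finset (Fin (r + 1))} {x : L A r} (h0 : x ∈ Ldeg A r 0)
    (h : ∀ m, x.coeff m ≠ 0 → ∀ i, i ∉ s → 0 ≤ m i) : x ∈ Bsub A r s := by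
  haveI : Nonempty Unit := ⟨()⟩
  rw [mem_Bsub_iff_const_mem_locDeg (J := Unit), mem_locDeg_top_iff]
  intro _ m hm
  exact ⟨by simpa using (mem_Ldeg.mp h0) m hm, h (m := m) hm⟩

/-- Membership in `B_s` in terms of monomials. [folklore] -/
theorem mem_Bsub_iff_nonneg {s : Finset (Fin (r + 1))} {x : L A r} :
    x ∈ Bsub A r s ↔ x ∈ Ldeg A r 0 ∧ ∀ m, x.coeff m ≠ 0 → ∀ i, i ∉ s → 0 ≤ m i :=
  ⟨fun hx => ⟨hx.1, fun _ hm _ hi => nonneg_of_mem_Bsub hx hm hi⟩, fun h => mem_Bsub_of_nonneg h.1 h.2⟩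

/-! ### `X_s` is homogeneous; the map `(P_{(X_s)})₀ → L` -/

/-- `X_s = Π_{i ∈ s} x_i` is homogeneous of degree `#s`. [folklore] -/
theorem Xs_mem (s : Finset (Fin (r + 1))) :
    Xs A s ∈ MvPolynomial.homogeneousSubmodule (Fin (r + 1)) A s.card := by
  rw [MvPolynomial.mem_homogeneousSubmodule, Xs]
  have := MvPolynomial.IsHomogeneous.prod s (fun i => MvPolynomial.X i) (fun _ => 1)
    fun i _ => MvPolynomial.isHomogeneous_X A i
  rwa [Finset.sum_const, smul_eq_mul, mul_one] at this

/-- Powers of the Laurent monomials: `(x_s^N)^n = x_s^{nN}`. [folklore] -/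
theorem xs_pow (s : Finset (Fin (r + 1))) (N : ℤ) (n : ℕ) : xs A s N ^ n = xs A s (n * N) := by
  induction n with
  | zero => simp
  | succ n ih => rw [pow_succ, ih, ← xs_add]; congr 1; push_cast; ring

/-- Powers of degree-zero Laurent polynomials have degree zero. [folklore] -/
theorem pow_mem_Ldeg_zero {x : L A r} (hx : x ∈ Ldeg A r 0) (k : ℕ) : x ^ k ∈ Ldeg A r 0 := by
  induction k with
  | zero => rw [pow_zero, AddMonoidAlgebra.one_def]; exact single_mem_Ldeg (by simp) 1
  | succ k ih => rw [pow_succ]; simpa using mul_mem_Ldeg ih hx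

/-- `toL (X_s)` is a unit of `L` (with inverse `x_s^{-1}`). [folklore] -/
theorem isUnit_toL_Xs (s : Finset (Fin (r + 1))) : IsUnit (toL A r (Xs A s)) := by
  rw [show Xs A s = Xs A s ^ 1 from (pow_one _).symm, toL_Xs_pow]
  exact isUnit_iff_exists_inv.mpr ⟨xs A s (-1), by simpa using xs_mul_xs_neg (A := A) s 1⟩

variable (A r) in
/-- **The embedding `(P_{(X_s)})₀ ↪ L`** of the degree-zero homogeneous localization of
`P = A[x₀, …, x_r]` at `X_s` into the Laurent polynomials: `p / X_s^n ↦ p · x_s^{-n}`. [folklore] -/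
def awayToL (s : Finset (Fin (r + 1))) :
    HomogeneousLocalization.Away (MvPolynomial.homogeneousSubmodule (Fin (r + 1)) A) (Xs A s) →+*
      L A r :=
  (Localization.awayLift (toL A r).toRingHom (Xs A s) (isUnit_toL_Xs s)).comp
    (algebraMap _ (Localization.Away (Xs A s)))

/-- The value of `awayToL` on a fraction `p / X_s^n` (for any witness that `X_s` is homogeneous).
[folklore] -/
theorem awayToL_mk (s : Finset (Fin (r + 1))) {d : ℕ}
    (hXs : Xs A s ∈ MvPolynomial.homogeneousSubmodule (Fin (r + 1)) A d) (n : ℕ) (p : P A r)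
    (hp : p ∈ MvPolynomial.homogeneousSubmodule (Fin (r + 1)) A (n • d)) :
    awayToL A r s (HomogeneousLocalization.Away.mk _ hXs n p hp) = toL A r p * xs A s (-n) := by
  rw [awayToL, RingHom.comp_apply, HomogeneousLocalization.algebraMap_apply,
    HomogeneousLocalization.Away.val_mk]
  have hv : (toL A r).toRingHom (Xs A s) * xs A s (-1) = 1 := by
    change toL A r (Xs A s) * xs A s (-1) = 1
    rw [show Xs A s = Xs A s ^ 1 from (pow_one _).symm, toL_Xs_pow]
    simpa using xs_mul_xs_neg (A := A) s 1
  rw [show (isUnit_toL_Xs (A := A) s) = isUnit_iff_exists_inv.mpr ⟨xs A s (-1), hv⟩ from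
    Subsingleton.elim _ _, Localization.awayLift_mk (hv := hv)]
  change toL A r p * xs A s (-1) ^ n = _
  rw [xs_pow, mul_neg_one]

/-- `awayToL` lands in `B_s`. [folklore] -/
theorem awayToL_mem_Bsub (s : Finset (Fin (r + 1)))
    (z : HomogeneousLocalization.Away (MvPolynomial.homogeneousSubmodule (Fin (r + 1)) A) (Xs A s)) :
    awayToL A r s z ∈ Bsub A r s := by
  obtain ⟨n, p, hp, rfl⟩ := HomogeneousLocalization.Away.mk_surjective _ (Xs_mem s) z
  rw [awayToL_mk]
  refine ⟨?_, n, p, ?_⟩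
  · have h1 : toL A r p ∈ Ldeg A r (n * s.card : ℕ) :=
      (toL_mem_Ldeg_iff p _).mpr (by simpa [smul_eq_mul] using hp)
    have := mul_mem_Ldeg h1 (xs_mem_Ldeg (A := A) s (-n))
    rwa [show ((n * s.card : ℕ) : ℤ) + -n * s.card = 0 by push_cast; ring] at this
  · rw [mul_comm (toL A r p), ← mul_assoc, xs_mul_xs_neg, one_mul]

/-- `awayToL` is injective. [folklore] -/
theorem awayToL_injective (s : Finset (Fin (r + 1))) : Function.Injective (awayToL A r s) := by
  rw [injective_iff_map_eq_zero]
  intro z hz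
  obtain ⟨n, p, hp, rfl⟩ := HomogeneousLocalization.Away.mk_surjective _ (Xs_mem s) z
  rw [awayToL_mk] at hz
  have hp0 : toL A r p = 0 := by
    have := congr_arg (· * xs A s n) hz
    simpa only [mul_assoc, xs_neg_mul_xs, mul_one, zero_mul] using this
  have : p = 0 := toL_injective (by rw [hp0, map_zero])
  subst this
  exact HomogeneousLocalization.mk_eq_zero_of_num _ rfl

/-- Every element of `B_s` is in the image of `awayToL`. [folklore] -/
theorem exists_awayToL_eq {s : Finset (Fin (r + 1))} {x : L A r} (hx : x ∈ Bsub A r s) :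
    ∃ z, awayToL A r s z = x := by
  obtain ⟨h0, N, p, hp⟩ := hx
  have hpdeg : p ∈ MvPolynomial.homogeneousSubmodule (Fin (r + 1)) A (N • s.card) := by
    rw [MvPolynomial.mem_homogeneousSubmodule, ← toL_mem_Ldeg_iff, ← hp]
    have := mul_mem_Ldeg (xs_mem_Ldeg (A := A) s N) h0
    simpa [smul_eq_mul] using this
  refine ⟨HomogeneousLocalization.Away.mk _ (Xs_mem s) N p hpdeg, ?_⟩
  rw [awayToL_mk, ← hp, mul_comm (xs A s N), mul_assoc, xs_mul_xs_neg, mul_one]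

variable (A r) in
/-- **`(P_{(X_s)})₀ ≅ B_s`**: the degree-zero homogeneous localization of `A[x₀, …, x_r]` at `X_s` is
isomorphic, via `awayToL`, to the subalgebra `B_s` of the Laurent polynomials (Hartshorne II
Prop. 2.5 (b) / proof of III Thm. 5.1: `S_{(x_{i₀} ⋯ x_{i_p})}` is spanned by Laurent monomials).
[folklore] -/
def awayEquiv (s : Finset (Fin (r + 1))) :
    HomogeneousLocalization.Away (MvPolynomial.homogeneousSubmodule (Fin (r + 1)) A) (Xs A s) ≃+*
      Bsub A r s :=
  RingEquiv.ofBijective ((awayToL A r s).codRestrict (Bsub A r s).toSubring.toSubsemiring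
      (awayToL_mem_Bsub s))
    ⟨fun z z' h => awayToL_injective s (congr_arg Subtype.val h),
      fun ⟨x, hx⟩ => by
        obtain ⟨z, hz⟩ := exists_awayToL_eq hx
        exact ⟨z, Subtype.ext hz⟩⟩

/-- The underlying Laurent polynomial of `awayEquiv s z` is `awayToL s z`. [folklore] -/
@[simp] theorem coe_awayEquiv (s : Finset (Fin (r + 1)))
    (z : HomogeneousLocalization.Away (MvPolynomial.homogeneousSubmodule (Fin (r + 1)) A) (Xs A s)) :
    (awayEquiv A r s z : L A r) = awayToL A r s z := rfl

/-- `awayToL` of `awayEquiv.symm x` is `x`. [folklore] -/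
@[simp] theorem awayToL_awayEquiv_symm (s : Finset (Fin (r + 1))) (x : Bsub A r s) :
    awayToL A r s ((awayEquiv A r s).symm x) = x := by
  have := (awayEquiv A r s).apply_symm_apply x
  exact congr_arg Subtype.val this

/-- The structure map `A → (P_{(X_s)})₀` (through `𝒜₀`) followed by `awayToL` is the structure map
of `L`. [folklore] -/
theorem awayToL_fromZeroRingHom (s : Finset (Fin (r + 1))) (a : A) :
    awayToL A r s (HomogeneousLocalization.fromZeroRingHom _ _
      (algebraMap A (MvPolynomial.homogeneousSubmodule (Fin (r + 1)) A 0) a)) =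
      algebraMap A (L A r) a := by
  rw [awayToL, RingHom.comp_apply, HomogeneousLocalization.algebraMap_apply]
  change Localization.awayLift _ _ _ (HomogeneousLocalization.val (HomogeneousLocalization.mk _)) = _
  rw [HomogeneousLocalization.val_mk]
  change Localization.awayLift _ _ _ (Localization.mk (MvPolynomial.C a) 1) = _
  rw [Localization.mk_one_eq_algebraMap, Localization.awayLift, IsLocalization.Away.lift,
    IsLocalization.lift_eq]
  change toL A r (MvPolynomial.C a) = _
  rw [← MvPolynomial.algebraMap_eq]
  exact (toL A r).commutes a

/-! ### Compatibility with the transition maps `(P_{(X_s)})₀ → (P_{(X_t)})₀` -/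

/-- For disjoint `s`, `s'`: `X_{s ∪ s'} = X_s X_{s'}`. [folklore] -/
theorem Xs_union {s s' : Finset (Fin (r + 1))} (h : Disjoint s s') : Xs A (s ∪ s') = Xs A s * Xs A s' := by
  rw [Xs, Xs, Xs, Finset.prod_union h]

/-- **`awayToL` is compatible with the transition maps**: for disjoint `s, s'` and `t = s ∪ s'`,
`awayToL t ∘ awayMap = awayToL s`, where `awayMap : (P_{(X_s)})₀ → (P_{(X_t)})₀` is Mathlib's
`p/X_s^i ↦ p X_{s'}^i / X_t^i`. [folklore] -/
theorem awayToL_awayMap {s s' t : Finset (Fin (r + 1))} (h : Disjoint s s') (ht : t = s ∪ s')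
    (hx : Xs A t = Xs A s * Xs A s')
    (z : HomogeneousLocalization.Away (MvPolynomial.homogeneousSubmodule (Fin (r + 1)) A) (Xs A s)) :
    awayToL A r t (HomogeneousLocalization.awayMap _ (Xs_mem s') hx z) = awayToL A r s z := by
  subst ht
  obtain ⟨n, p, hp, rfl⟩ := HomogeneousLocalization.Away.mk_surjective _ (Xs_mem s) z
  rw [HomogeneousLocalization.awayMap_mk, awayToL_mk, awayToL_mk, map_mul, toL_Xs_pow,
    xs_eq_sdiff_mul (Finset.subset_union_left (s₂ := s')) (-n), Finset.union_sdiff_cancel_left h,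
    mul_assoc, ← mul_assoc (xs A s' n), xs_mul_xs_neg, one_mul]

/-! ### The transition element `t_{s,j} = X_{s ∖ j} / x_j^{#(s ∖ j)}` -/

/-- The Laurent polynomial `t_{s,j} = X_{s∖j} · x_j^{-#(s∖j)} ∈ B_{{j}}`, image of Mathlib's
`Away.isLocalizationElem` for `f = x_j`, `g = X_{s ∖ j}`: `D₊(x_j X_{s∖j}) = D₊(x_j) ∩ D(t_{s,j})`. [folklore] -/
def tEl (A : Type u) [CommRing A] (s : Finset (Fin (r + 1))) (j : Fin (r + 1)) : L A r :=
  toL A r (Xs A (s.erase j)) * xs A {j} (-((s.erase j).card : ℤ))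

/-- `t_{s,j} ∈ B_{{j}}`. [folklore] -/
theorem tEl_mem (s : Finset (Fin (r + 1))) (j : Fin (r + 1)) : tEl A s j ∈ Bsub A r {j} := by
  unfold tEl
  refine ⟨?_, (s.erase j).card, Xs A (s.erase j), ?_⟩
  · have h1 : toL A r (Xs A (s.erase j)) ∈ Ldeg A r (s.erase j).card := by
      rw [show Xs A (s.erase j) = Xs A (s.erase j) ^ 1 from (pow_one _).symm, toL_Xs_pow]
      simpa using xs_mem_Ldeg (A := A) (s.erase j) 1
    have := mul_mem_Ldeg h1 (xs_mem_Ldeg (A := A) {j} (-((s.erase j).card : ℤ)))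
    rwa [Finset.card_singleton, Nat.cast_one, mul_one, add_neg_cancel] at this
  · rw [mul_comm (toL A r _), ← mul_assoc, xs_mul_xs_neg, one_mul]

/-- `x_j · X_{s ∖ j} = X_{s + j}`. [folklore] -/
theorem X_mul_Xs_erase (s : Finset (Fin (r + 1))) (j : Fin (r + 1)) :
    MvPolynomial.X j * Xs A (s.erase j) = Xs A (insert j s) := by
  have hins : insert j (s.erase j) = insert j s := by
    ext i; by_cases h : i = j <;> simp [h]
  rw [Xs, Xs, ← Finset.prod_insert (Finset.notMem_erase j s), hins]

/-- **Clearing denominators**: for `x ∈ B_{s + j}`, `x · t_{s,j}^k ∈ B_{{j}}` for all large `k`.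
[folklore] -/
theorem exists_mul_tEl_pow_mem {s : Finset (Fin (r + 1))} {j : Fin (r + 1)} {x : L A r}
    (hx : x ∈ Bsub A r (insert j s)) : ∃ k₀ : ℕ, ∀ k, k₀ ≤ k → x * tEl A s j ^ k ∈ Bsub A r {j} := by
  classical
  -- a bound on the negative exponents of `x` at the indices of `s ∖ j`
  obtain ⟨B, hB⟩ : ∃ B : ℕ, ∀ m, x.coeff m ≠ 0 → ∀ i, -(B : ℤ) ≤ m i := by
    refine ⟨x.coeff.support.sup fun m => Finset.univ.sup fun i => (m i).natAbs, fun m hm i => ?_⟩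
    have h1 : (m i).natAbs ≤ Finset.univ.sup fun i => (m i).natAbs :=
      Finset.le_sup (f := fun i => (m i).natAbs) (Finset.mem_univ i)
    have h2 : (Finset.univ.sup fun i => (m i).natAbs) ≤
        x.coeff.support.sup fun m => Finset.univ.sup fun i => (m i).natAbs :=
      Finset.le_sup (f := fun m : Expt r => Finset.univ.sup fun i => (m i).natAbs) (by simpa using hm)
    have := h1.trans h2
    omega
  refine ⟨B, fun k hk => ?_⟩
  have htk : tEl A s j ^ k = toL A r (Xs A (s.erase j) ^ k) * xs A {j} (-(k * (s.erase j).card : ℤ)) := by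
    rw [tEl, mul_pow, ← map_pow, xs, AddMonoidAlgebra.single_pow, one_pow, xs]
    congr 2
    ext i
    simp only [Pi.smul_apply, sx_apply, Finset.mem_singleton]
    split_ifs <;> ring
  rw [mem_Bsub_iff_nonneg]
  constructor
  · have h1 := (mem_Bsub_iff_nonneg.mp hx).1
    have h2 := pow_mem_Ldeg_zero (tEl_mem (A := A) s j).1 k
    simpa using mul_mem_Ldeg h1 h2
  · intro m hm i hi
    rw [Finset.mem_singleton] at hi
    rw [htk, toL_Xs_pow, xs, xs, AddMonoidAlgebra.single_mul_single, one_mul, mul_comm,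
      coeff_single_mul, one_mul] at hm
    have hx' := mem_Bsub_iff_nonneg.mp hx
    have hnn := hx'.2 _ hm
    have hBm := hB _ hm
    simp only [Pi.sub_apply, Pi.add_apply, sx_apply, Finset.mem_singleton, Finset.mem_erase,
      Finset.mem_insert] at hnn hBm
    by_cases his : i ∈ s
    · -- `i ∈ s ∖ j`: the exponent of `x` at `i` is shifted by `+k ≥ B`
      have := hBm i
      simp only [hi, his, if_false, ne_eq, not_false_eq_true, and_self, if_true] at this
      omega
    · have := hnn i (by simp [hi, his])
      simp only [hi, his, if_false, ne_eq, not_false_eq_true, and_false] at this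
      simpa using this

/-- The identity `x_s^{M} · x_j^{-M #s} = t_{s,j}^M` relating the generator condition at `j` of the
ideal of a closed subscheme with the transition element (both for `j ∈ s` and `j ∉ s`, as
`X_{s + j} = x_j X_{s ∖ j}`). [folklore] -/
theorem xs_mul_xs_single_eq_tEl_pow (s : Finset (Fin (r + 1))) (j : Fin (r + 1)) (M : ℕ) :
    xs A s M * xs A {j} (-(M * s.card : ℤ)) = tEl A s j ^ M := by
  rw [tEl, mul_pow, ← map_pow, toL_Xs_pow, xs_pow, xs, xs, xs, xs,
    AddMonoidAlgebra.single_mul_single, AddMonoidAlgebra.single_mul_single, mul_one]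
  congr 1
  ext i
  simp only [Pi.add_apply, sx_apply, Finset.mem_singleton, Finset.mem_erase]
  by_cases hij : i = j
  · subst hij
    by_cases hj : i ∈ s
    · have hcard : (s.card : ℤ) = (s.erase i).card + 1 := by
        rw [Finset.card_erase_of_mem hj]; have := Finset.card_pos.mpr ⟨i, hj⟩; omega
      simp [hj, hcard]; ring
    · rw [Finset.erase_eq_of_notMem hj]; simp [hj]
  · simp [hij]

/-! ### Homogeneous components and the fractions `k_b / x_j^b` -/

/-- `hcomp` at a natural-number degree is Mathlib's `homogeneousComponent`. [folklore] -/
theorem hcomp_natCast (b : ℕ) (k : P A r) : hcomp (b : ℤ) k = MvPolynomial.homogeneousComponent b k := by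
  rw [hcomp, if_pos (Int.natCast_nonneg b)]
  rfl

/-- `hcomp b k` vanishes for `b < 0`. [folklore] -/
theorem hcomp_of_neg {b : ℤ} (hb : b < 0) (k : P A r) : hcomp b k = 0 := by
  rw [hcomp, if_neg (not_le.mpr hb)]
  rfl

/-- `toL (hcomp b k) ∈ L_b`. [folklore] -/
theorem toL_hcomp_mem_Ldeg (b : ℤ) (k : P A r) : toL A r (hcomp b k) ∈ Ldeg A r b := by
  rw [toL_hcomp, mem_Ldeg]
  intro m hm
  rw [coeff_Lfilter] at hm
  split_ifs at hm with h
  · exact h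
  · exact absurd rfl hm

/-- Iterated homogeneous components. [folklore] -/
theorem hcomp_hcomp (b dd : ℤ) (k : P A r) : hcomp b (hcomp dd k) = if b = dd then hcomp dd k else 0 := by
  apply toL_injective
  rw [toL_hcomp]
  split_ifs with h
  · subst h; exact Lfilter_edeg_of_mem (toL_hcomp_mem_Ldeg b k)
  · rw [map_zero]; exact Lfilter_edeg_of_mem_ne (toL_hcomp_mem_Ldeg dd k) h

/-- A polynomial whose image in `L` has degree `D` is its own degree-`D` component. [folklore] -/
theorem hcomp_eq_self_of_toL_mem {D : ℤ} {k : P A r} (h : toL A r k ∈ Ldeg A r D) : hcomp D k = k := by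
  apply toL_injective
  rw [toL_hcomp]
  exact Lfilter_edeg_of_mem h

/-- **A polynomial is the (finite) sum of its integer-degree homogeneous components** (Mathlib
`MvPolynomial.sum_homogeneousComponent`). [folklore] -/
theorem sum_hcomp (k : P A r) : ∑ c ∈ Finset.range (k.totalDegree + 1), hcomp (c : ℤ) k = k := by
  conv_rhs => rw [← MvPolynomial.sum_homogeneousComponent (φ := k)]
  exact Finset.sum_congr rfl fun c _ => hcomp_natCast c k

/-- **Homogeneous components of a product**: `(g k)_b = Σ_c g_{b - c} k_c`. [folklore] -/
theorem hcomp_mul (b : ℤ) (g k : P A r) :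
    hcomp b (g * k) = ∑ c ∈ Finset.range (k.totalDegree + 1), hcomp (b - c) g * hcomp (c : ℤ) k := by
  apply toL_injective
  rw [toL_hcomp, map_mul (toL A r), map_sum]
  conv_lhs => rw [← sum_hcomp k]; rw [map_sum, Finset.mul_sum, map_sum]
  refine Finset.sum_congr rfl fun c _ => ?_
  rw [Lfilter_edeg_mul_of_mem _ (toL_hcomp_mem_Ldeg c k), map_mul (toL A r), toL_hcomp, toL_hcomp]

/-- `X_{{j}} = x_j`. [folklore] -/
theorem Xs_singleton (j : Fin (r + 1)) : Xs A {j} = MvPolynomial.X j := by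
  rw [Xs, Finset.prod_singleton]

/-- A Laurent monomial of degree `0` which is non-negative off `s` lies in `B_s`. [folklore] -/
theorem single_one_mem_Bsub {s : Finset (Fin (r + 1))} {m : Expt r} (h0 : edeg r m = 0)
    (h : ∀ i, i ∉ s → 0 ≤ m i) : AddMonoidAlgebra.single m (1 : A) ∈ Bsub A r s := by
  refine mem_Bsub_of_nonneg (single_mem_Ldeg h0 1) fun m' hm' i hi => ?_
  rw [AddMonoidAlgebra.coeff_single, Finsupp.single_apply] at hm'
  split_ifs at hm' with hmm
  · rw [← hmm]; exact h i hi
  · exact absurd rfl hm'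

/-- The fraction `k_b / x_j^b ∈ L` (`k_b` the degree-`b` component of `k`). [folklore] -/
def fracL (A : Type u) [CommRing A] (j : Fin (r + 1)) (b : ℤ) (k : P A r) : L A r :=
  toL A r (hcomp b k) * xs A {j} (-b)

/-- `k_b / x_j^b ∈ B_{{j}}`. [folklore] -/
theorem fracL_mem (j : Fin (r + 1)) (b : ℤ) (k : P A r) : fracL A j b k ∈ Bsub A r {j} := by
  rcases lt_or_ge b 0 with hb | hb
  · rw [fracL, hcomp_of_neg hb, map_zero, zero_mul]
    exact Subalgebra.zero_mem _
  · obtain ⟨n, rfl⟩ := Int.eq_ofNat_of_zero_le hb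
    refine ⟨?_, n, hcomp n k, ?_⟩
    · have := mul_mem_Ldeg (toL_hcomp_mem_Ldeg (A := A) n k) (xs_mem_Ldeg (A := A) {j} (-n))
      rw [Finset.card_singleton, Nat.cast_one, mul_one, add_neg_cancel] at this
      exact this
    · rw [fracL, mul_comm (toL A r _), ← mul_assoc, xs_mul_xs_neg, one_mul]

/-- The fraction `k_b / x_j^b` as an element of `B_{{j}}`. [folklore] -/
def fracB (A : Type u) [CommRing A] (j : Fin (r + 1)) (b : ℤ) (k : P A r) : Bsub A r {j} :=
  ⟨fracL A j b k, fracL_mem j b k⟩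

/-- The underlying Laurent polynomial of `fracB`. [folklore] -/
@[simp] theorem coe_fracB (j : Fin (r + 1)) (b : ℤ) (k : P A r) : (fracB A j b k : L A r) = fracL A j b k := rfl

/-- `fracB` is additive in the polynomial. [folklore] -/
theorem fracB_add (j : Fin (r + 1)) (b : ℤ) (k k' : P A r) : fracB A j b (k + k') = fracB A j b k + fracB A j b k' := by
  apply Subtype.ext
  change fracL A j b (k + k') = fracL A j b k + fracL A j b k'
  rw [fracL, fracL, fracL, map_add, map_add, add_mul]

/-- `fracB` of zero. [folklore] -/
@[simp] theorem fracB_zero (j : Fin (r + 1)) (b : ℤ) : fracB A j b (0 : P A r) = 0 := by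
  apply Subtype.ext
  change fracL A j b 0 = 0
  rw [fracL, map_zero, map_zero, zero_mul]

/-- **Fractions of a product**: `(g k)_b / x_j^b = Σ_c (g_{b-c} / x_j^{b-c}) (k_c / x_j^c)`. [folklore] -/
theorem fracB_mul (j : Fin (r + 1)) (b : ℤ) (g k : P A r) :
    fracB A j b (g * k) =
      ∑ c ∈ Finset.range (k.totalDegree + 1), fracB A j (b - c) g * fracB A j c k := by
  apply Subtype.ext
  rw [coe_fracB, ← Subalgebra.val_apply, map_sum]
  simp only [Subalgebra.val_apply, MulMemClass.coe_mul, coe_fracB]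
  rw [fracL, hcomp_mul, map_sum, Finset.sum_mul]
  refine Finset.sum_congr rfl fun c _ => ?_
  rw [fracL, fracL, map_mul, show -b = -(b - c) + -(c : ℤ) by ring, xs_add]
  ring

/-- Iterated components: `(k_{dd})_b / x_j^b` is `k_{dd}/x_j^{dd}` for `b = dd` and `0` otherwise. [folklore] -/
theorem fracB_hcomp (j : Fin (r + 1)) (b dd : ℤ) (k : P A r) :
    fracB A j b (hcomp dd k) = if b = dd then fracB A j dd k else 0 := by
  apply Subtype.ext
  rw [coe_fracB, fracL, hcomp_hcomp]
  split_ifs with h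
  · subst h; rfl
  · rw [map_zero, zero_mul]; rfl

end LaurentCech

end Literature.Algebra.Homology
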